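import Mathlib
import Summits.CriticalPhenomena.CardyFormulaZ2.Theorems.CardySelfRefinementDefs
import Literature.Probability.Percolation.ThinAnnulusCircuits
import Literature.Probability.Percolation.IsoradialProofs
import Literature.Probability.Percolation.SelfRefinementMeasure
import HarnessLib

/-!
# Helper `circuitsAlong` (M1) of stub `stub_fourArmAboveOne`, line `far-field-is-a-quarter-turn`
(crux `TrivialSectorRate`, stmt-CriticalPhenomena-10266): one-box RSW bounds for lattice rectangles

The RSW input of an admissible path is the clause
`BoxCrossingBounds (M k (γ s).1 (γ s).2) squareLatticeEmbedding.z ρ c₀ n₀` of `PathOK`: two-sided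
bounds `[c₀, 1 - c₀]` for the EMBEDDED crossing events `embRectCrossing` / `embTBCrossing` of the
Euclidean rectangles `w + [0, ρ n] × [0, n]`, `w + [0, n] × [0, ρ n]` of the drawing `√2 ℤ² - w`.
The gluing constructions of `ThinAnnulusCircuits.lean` need bounds for crossings of LATTICE
rectangles `u + [0, M] × [0, N]` (`lrCrossingAt`, and its top-bottom companion).  This file is the
dictionary, for an arbitrary measure `μ` carried by lattice configurations:

* `le_real_lrCrossingAt_of_boxCrossingBounds` — LOWER bound `c₀ ≤ μ(LR(u + [0,M] × [0,N]))` when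
  `n ≤ √2 N + 1`, `√2 M - 1 ≤ ρ n`, `n ≥ n₀` (the embedded horizontal crossing of
  `√2 u + [0, ρ n] × [0, n]` contains a lattice crossing, `mem_shift_lrCrossing_of_mem_embRectCrossing`);
* `real_lrCrossingAt_le_of_boxCrossingBounds`, `real_tbCrossingAt_le_of_boxCrossingBounds` — UPPER
  bounds `≤ 1 - c₀` when the lattice rectangle spans the embedded one
  (`shift_lrCrossing_subset_embRectCrossing` and its vertical companion
  `shift_tbCrossing_subset_embTBCrossing`);
* `M_real_tbCrossingAt_eq` — for the self-refinement law `M_k(ρ,c)` a vertical crossing has the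
  probability of the horizontal crossing of the transposed rectangle (transposition invariance,
  `selfRefinementMeasure_real_preimage_relabel_transpose`), so the lower bound transfers to
  top-bottom crossings.

References: G. Grimmett, *Percolation* (1999), §11.7; G. Grimmett, I. Manolescu, PTRF 159 (2014),
§2.2–2.3 (box-crossing property of `√2 ℤ²`).
-/

noncomputable section

namespace Summit.CriticalPhenomena.CardyFormulaZ2.Theorems.CardySelfRefinement.FarField

open Set MeasureTheory
open Literature.Probability.LatticeModels Literature.Probability.Percolation
open Literature.Probability.Percolation.QuadCrossing
open Summit.CriticalPhenomena.CardyFormulaZ2.Theses.CardySelfRefinement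

/-! ### The dictionary: lattice rectangles and embedded rectangles of `√2 ℤ² - w` -/

-- adapted from Literature/Probability/Percolation/IsoradialProofs.lean (`shift_lrCrossing_subset_embRectCrossing`)
/-- **A lattice rectangle inside an embedded one, vertically.** If the translated lattice rectangle
`(i, j) + [0, M] × [0, N]`, drawn by `v ↦ √2 v - w`, lies in the strip `[0, a'] × [-2, b' + 2]` with
its bottom row in `{im ≤ 0}` and its top row in `{b' ≤ im}`, then an open top-bottom crossing of
it is an open vertical crossing of `[0, a'] × [0, b']` in the sense of `embTBCrossing`. -/
theorem shift_tbCrossing_subset_embTBCrossing (w : ℂ) (a' b' : ℝ) (i j : ℤ) (M N : ℕ)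
    (g1 : w.re ≤ Real.sqrt 2 * i) (g2 : Real.sqrt 2 * (i + M) ≤ w.re + a')
    (g3 : Real.sqrt 2 * j ≤ w.im) (g4 : w.im - 2 ≤ Real.sqrt 2 * j)
    (g5 : w.im + b' ≤ Real.sqrt 2 * (j + N)) (g6 : Real.sqrt 2 * (j + N) ≤ w.im + b' + 2) :
    openCrossing ((· + ![i, j]) '' (rectangle M N : Set (Site 2)))
        ((· + ![i, j]) '' (bottomSide M N : Set (Site 2))) ((· + ![i, j]) '' (topSide M N : Set (Site 2))) ⊆
      embTBCrossing (fun v => squareLatticeEmbedding.z v - w) a' b' := by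
  have hs : 0 < Real.sqrt 2 := Real.sqrt_pos.2 (by norm_num)
  refine openCrossing_mono ?_ ?_ ?_
  · intro z hz
    rw [mem_image_add_rectangle] at hz
    simp only [Matrix.cons_val_zero, Matrix.cons_val_one] at hz
    obtain ⟨hz1, hz2, hz3, hz4⟩ := hz
    have e1 : (i : ℝ) ≤ z 0 := by exact_mod_cast hz1
    have e2 : (z 0 : ℝ) ≤ i + M := by exact_mod_cast hz2
    have e3 : (j : ℝ) ≤ z 1 := by exact_mod_cast hz3
    have e4 : (z 1 : ℝ) ≤ j + N := by exact_mod_cast hz4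
    simp only [mem_setOf_eq, squareLatticeEmbedding_z_sub_re, squareLatticeEmbedding_z_sub_im,
      mem_Icc]
    refine ⟨⟨?_, ?_⟩, ?_, ?_⟩ <;> nlinarith
  · intro z hz
    rw [mem_image_add_bottomSide] at hz
    simp only [Matrix.cons_val_zero, Matrix.cons_val_one] at hz
    have e : (z 1 : ℝ) = j := by exact_mod_cast hz.2
    simp only [mem_setOf_eq, squareLatticeEmbedding_z_sub_im]
    rw [e]; linarith
  · intro z hz
    rw [mem_image_add_topSide] at hz
    simp only [Matrix.cons_val_zero, Matrix.cons_val_one] at hz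
    have e : (z 1 : ℝ) = j + N := by exact_mod_cast hz.2
    simp only [mem_setOf_eq, squareLatticeEmbedding_z_sub_im]
    rw [e]; linarith

/-- `![u 0, u 1] = u`. -/
theorem vec_two_eta (u : Site 2) : ![u 0, u 1] = u := by
  ext i; fin_cases i <;> rfl

/-- **RSW lower bound for a lattice rectangle** from embedded box-crossing bounds.  If `μ` is carried
by lattice configurations and satisfies `BoxCrossingBounds μ √2ℤ² ρ c₀ n₀`, then every translated
lattice rectangle `u + [0, M] × [0, N]` with `n ≤ √2 N + 1` and `√2 M - 1 ≤ ρ n` for some scale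
`n ≥ n₀` is crossed from left to right with probability `≥ c₀` (the embedded horizontal crossing
of `w + [0, ρ n] × [0, n]`, `w = √2 u`, contains such a lattice crossing). -/
theorem le_real_lrCrossingAt_of_boxCrossingBounds {μ : Measure (BondConfig (Site 2))}
    [IsFiniteMeasure μ] (hae : ∀ᵐ ω ∂μ, ω ⊆ (zdGraph 2).edgeSet) {ρ c₀ : ℝ} {n₀ : ℕ}
    (hbox : BoxCrossingBounds μ squareLatticeEmbedding.z ρ c₀ n₀) (u : Site 2) (M N : ℕ) {n : ℕ}
    (hn : n₀ ≤ n) (h1 : (n : ℝ) ≤ Real.sqrt 2 * N + 1) (h2 : Real.sqrt 2 * M - 1 ≤ ρ * n) :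
    c₀ ≤ μ.real (lrCrossingAt u M N) := by
  have hs := one_lt_sqrt_two_and_lt_two
  have hs0 : 0 < Real.sqrt 2 := by linarith
  obtain ⟨w, hwre, hwim⟩ : ∃ w : ℂ, w.re = Real.sqrt 2 * (u 0 : ℝ) ∧ w.im = Real.sqrt 2 * (u 1 : ℝ) :=
    ⟨⟨_, _⟩, rfl, rfl⟩
  have hb := (hbox n hn w).1.1
  refine hb.trans (ENNReal.toReal_mono (measure_ne_top _ _) (measure_mono_ae ?_))
  filter_upwards [hae] with ω hω h
  have hiL : ∀ t : ℤ, Real.sqrt 2 * t ≤ w.re → t ≤ u 0 := by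
    intro t ht
    rw [hwre] at ht
    have : (t : ℝ) ≤ u 0 := le_of_mul_le_mul_left ht hs0
    exact_mod_cast this
  have hiR : ∀ t : ℤ, w.re + ρ * n ≤ Real.sqrt 2 * t → u 0 + M ≤ t := by
    intro t ht
    rw [hwre] at ht
    by_contra hlt
    have hlt' : (t : ℝ) + 1 ≤ (u 0 : ℝ) + M := by exact_mod_cast (show t + 1 ≤ u 0 + M by omega)
    have hm := mul_le_mul_of_nonneg_left hlt' hs0.le
    linarith [hs.1]
  have hjB : ∀ t : ℤ, w.im ≤ Real.sqrt 2 * t → u 1 ≤ t := by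
    intro t ht
    rw [hwim] at ht
    have : (u 1 : ℝ) ≤ t := le_of_mul_le_mul_left ht hs0
    exact_mod_cast this
  have hjT : ∀ t : ℤ, Real.sqrt 2 * t ≤ w.im + n → t ≤ u 1 + N := by
    intro t ht
    rw [hwim] at ht
    by_contra hlt
    have hlt' : (u 1 : ℝ) + N + 1 ≤ t := by exact_mod_cast (show u 1 + N + 1 ≤ t by omega)
    have hm := mul_le_mul_of_nonneg_left hlt' hs0.le
    linarith [hs.1]
  have key := mem_shift_lrCrossing_of_mem_embRectCrossing hω w (ρ * n) n (u 0) (u 0 + M) (u 1)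
    (u 1 + N) hiL hiR (by omega) hjB hjT h
  have e1 : (u 0 + (M : ℤ) - u 0).toNat = M := by simp
  have e2 : (u 1 + (N : ℤ) - u 1).toNat = N := by simp
  rw [e1, e2, vec_two_eta] at key
  exact key

/-- **RSW upper bound for a lattice rectangle, horizontally.**  Under `BoxCrossingBounds μ √2ℤ² ρ c₀ n₀`,
a translated lattice rectangle `u + [0, M] × [0, N]` with `√2 N ≤ n` and `√2 M - 2 ≤ ρ n ≤ √2 M`
for some scale `n ≥ n₀` is crossed from left to right with probability `≤ 1 - c₀` (such a crossing
is an embedded horizontal crossing of `w + [0, ρ n] × [0, n]`, `w = √2 u`). -/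
theorem real_lrCrossingAt_le_of_boxCrossingBounds {μ : Measure (BondConfig (Site 2))}
    [IsFiniteMeasure μ] {ρ c₀ : ℝ} {n₀ : ℕ}
    (hbox : BoxCrossingBounds μ squareLatticeEmbedding.z ρ c₀ n₀) (u : Site 2) (M N : ℕ) {n : ℕ}
    (hn : n₀ ≤ n) (h1 : Real.sqrt 2 * N ≤ n) (h2 : Real.sqrt 2 * M - 2 ≤ ρ * n)
    (h3 : ρ * n ≤ Real.sqrt 2 * M) :
    μ.real (lrCrossingAt u M N) ≤ 1 - c₀ := by
  obtain ⟨w, hwre, hwim⟩ : ∃ w : ℂ, w.re = Real.sqrt 2 * (u 0 : ℝ) ∧ w.im = Real.sqrt 2 * (u 1 : ℝ) :=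
    ⟨⟨_, _⟩, rfl, rfl⟩
  have hb := (hbox n hn w).1.2
  refine le_trans (measureReal_mono ?_) hb
  have hsub := shift_lrCrossing_subset_embRectCrossing w (ρ * n) n (u 0) (u 1) M N
    (by rw [hwre]) (by rw [hwre]; linarith) (by rw [hwre]; linarith) (by rw [hwre]; linarith)
    (by rw [hwim]) (by rw [hwim]; linarith)
  rw [vec_two_eta] at hsub
  exact hsub

/-- **RSW upper bound for a lattice rectangle, vertically.**  Under `BoxCrossingBounds μ √2ℤ² ρ c₀ n₀`,
a translated lattice rectangle `u + [0, M] × [0, N]` with `√2 M ≤ n` and `√2 N - 2 ≤ ρ n ≤ √2 N`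
for some scale `n ≥ n₀` is crossed from bottom to top with probability `≤ 1 - c₀`. -/
theorem real_tbCrossingAt_le_of_boxCrossingBounds {μ : Measure (BondConfig (Site 2))}
    [IsFiniteMeasure μ] {ρ c₀ : ℝ} {n₀ : ℕ}
    (hbox : BoxCrossingBounds μ squareLatticeEmbedding.z ρ c₀ n₀) (u : Site 2) (M N : ℕ) {n : ℕ}
    (hn : n₀ ≤ n) (h1 : Real.sqrt 2 * M ≤ n) (h2 : Real.sqrt 2 * N - 2 ≤ ρ * n)
    (h3 : ρ * n ≤ Real.sqrt 2 * N) :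
    μ.real (openCrossing ((· + u) '' (rectangle M N : Set (Site 2)))
      ((· + u) '' (bottomSide M N : Set (Site 2))) ((· + u) '' (topSide M N : Set (Site 2)))) ≤ 1 - c₀ := by
  obtain ⟨w, hwre, hwim⟩ : ∃ w : ℂ, w.re = Real.sqrt 2 * (u 0 : ℝ) ∧ w.im = Real.sqrt 2 * (u 1 : ℝ) :=
    ⟨⟨_, _⟩, rfl, rfl⟩
  have hb := (hbox n hn w).2.2
  refine le_trans (measureReal_mono ?_) hb
  have hsub := shift_tbCrossing_subset_embTBCrossing w n (ρ * n) (u 0) (u 1) M N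
    (by rw [hwre]) (by rw [hwre]; linarith) (by rw [hwim]) (by rw [hwim]; linarith)
    (by rw [hwim]; linarith) (by rw [hwim]; linarith)
  rw [vec_two_eta] at hsub
  exact hsub

/-! ### Vertical crossings of `M_k` by transposition -/

/-- The transpose of the translated rectangle `u + [0, M] × [0, N]` is `uᵀ + [0, N] × [0, M]`. -/
theorem preimage_transpose_image_add_rectangle (u : Site 2) (M N : ℕ) :
    (⇑transposeIso) ⁻¹' ((· + u) '' (rectangle M N : Set (Site 2))) =
      (· + ![u 1, u 0]) '' (rectangle N M : Set (Site 2)) := by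
  ext z
  simp only [Set.mem_preimage, mem_image_add_rectangle, transposeIso_apply_zero,
    transposeIso_apply_one, Matrix.cons_val_zero, Matrix.cons_val_one]
  tauto

/-- The transpose of the bottom side of `u + [0, M] × [0, N]` is the left side of `uᵀ + [0, N] × [0, M]`. -/
theorem preimage_transpose_image_add_bottomSide (u : Site 2) (M N : ℕ) :
    (⇑transposeIso) ⁻¹' ((· + u) '' (bottomSide M N : Set (Site 2))) =
      (· + ![u 1, u 0]) '' (leftSide N M : Set (Site 2)) := by
  ext z
  simp only [Set.mem_preimage, mem_image_add_bottomSide, mem_image_add_leftSide,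
    transposeIso_apply_zero, transposeIso_apply_one, Matrix.cons_val_zero, Matrix.cons_val_one]
  tauto

/-- The transpose of the top side of `u + [0, M] × [0, N]` is the right side of `uᵀ + [0, N] × [0, M]`. -/
theorem preimage_transpose_image_add_topSide (u : Site 2) (M N : ℕ) :
    (⇑transposeIso) ⁻¹' ((· + u) '' (topSide M N : Set (Site 2))) =
      (· + ![u 1, u 0]) '' (rightSide N M : Set (Site 2)) := by
  ext z
  simp only [Set.mem_preimage, mem_image_add_topSide, mem_image_add_rightSide,
    transposeIso_apply_zero, transposeIso_apply_one, Matrix.cons_val_zero, Matrix.cons_val_one]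
  tauto

/-- **Vertical crossings of `M_k` are horizontal crossings of the transposed rectangle**: the
`M_k(ρ,c)`-probability of an open top-bottom crossing of `u + [0, M] × [0, N]` equals that of an
open left-right crossing of `uᵀ + [0, N] × [0, M]` (`M_k` is invariant under the transposition of
the axes, `selfRefinementMeasure_real_preimage_relabel_transpose`). -/
theorem M_real_tbCrossingAt_eq (k : ℕ) (ρ c : ℝ) (u : Site 2) (M' N : ℕ) :
    (M k ρ c).real (openCrossing ((· + u) '' (rectangle M' N : Set (Site 2)))
      ((· + u) '' (bottomSide M' N : Set (Site 2))) ((· + u) '' (topSide M' N : Set (Site 2)))) =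
      (M k ρ c).real (lrCrossingAt ![u 1, u 0] N M') := by
  have key : BondConfig.relabel (sym2Equiv transposeIso.toEquiv) ⁻¹' lrCrossingAt ![u 1, u 0] N M' =
      openCrossing ((· + u) '' (rectangle M' N : Set (Site 2)))
        ((· + u) '' (bottomSide M' N : Set (Site 2))) ((· + u) '' (topSide M' N : Set (Site 2))) := by
    rw [lrCrossingAt, ← preimage_transpose_image_add_rectangle,
      ← preimage_transpose_image_add_bottomSide, ← preimage_transpose_image_add_topSide,
      ← image_transposeIso, ← image_transposeIso, ← image_transposeIso]
    exact preimage_relabel_openCrossing transposeIso.toEquiv _ _ _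
  rw [← key]
  exact selfRefinementMeasure_real_preimage_relabel_transpose k ρ c _

end Summit.CriticalPhenomena.CardyFormulaZ2.Theorems.CardySelfRefinement.FarField

end
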